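import Summits.FinalStateConjecture.FinalStateConjecture.Theorems.PhotonSphereChannelsDarkFutureDefs
import Summits.FinalStateConjecture.FinalStateConjecture.Theorems.PhotonSphereChannelsChannelsResolveTameDevelopmentsRSubspacetimeCausality
import Literature.Geometry.Lorentzian.CauchyDevelopmentRestrict
import HarnessLib

/-!
# Route PhotonSphereChannels · crux `ChannelsResolveTameDevelopmentsR` (K2R-T2, stmt-FinalStateConjecture-17430) ·
# line `tame-lasalle-dock` · stub D `stub_dockReadyHull`: TRANSPORT of an end datum to an open sub-spacetime
# (far chart, clock, d.o.c., horizon, far deviation, tameness at every order, all-orders class)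

The representative of stub D (case A) is the open sub-spacetime `U ⊇ E.doc ∪ range E.far` of a hull element `(𝓢, E, p)`
(`Spacetime.restrict`), carrying the TRANSPORTED end datum — same reference mass / far cylinder / far constant, far chart
co-restricted to `U`, clock restricted to `U` — written throughout as the term
`⟨E.M, E.R, E.C, fun x ↦ ⟨E.far x, hfar x⟩, fun y ↦ E.clock y.1⟩` (no definition is introduced). This file proves
that transport preserves everything in `IsTameClass` except what it cannot: the clock-adapted tame balls, which must be
GIVEN inside `U` (hypothesis `hballs`: the body of `IsTameEndOrder.tame` plus `∀ x, Ψ x ∈ U` — this is exactly the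
"collar" that `U` must contain):

* §1 `mfderiv_opensCodRestrict`, `contMDiff_opensCodRestrict`, `isLocalDiffeomorph_opensCodRestrict` — calculus of the
  co-restriction `x ↦ ⟨f x, _⟩ : X → U` of a map into an open submanifold (`dι = id`);
* §2 `deviation_restrict_opensCodRestrict`, `deviationExtend_restrict_opensCodRestrict`, `isLateChart_restrict_opensCodRestrict`
  — the chart deviation `Ψ^* g − g₀` and late charts are unchanged by reading `Ψ` in `𝓢|_U`;
* §3 `doc_transport`, `horizon_transport`, `h_transport`, `hdot_transport`, `isNonRadiating_transport_iff` — the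
  transported end has d.o.c. `ι⁻¹ E.doc`, horizon `ι⁻¹ E.horizon` (`…RSubspacetimeCausality`), the same far deviation;
* §4 `isRicciFlat_restrict` (vacuum restricts, `ricci_comap_apply`), `isTameEndOrder_transport`, `isTameEnd_transport`,
  `isTameClass_transport` (registered sub-goal) — the transported end is in the same all-orders class `(Λ, r₀)` as soon as
  `U ⊇ E.doc ∪ range E.far` contains, for every order `k` and every `q ∈ E.doc`, a clock-adapted centred tame ball of `E`.

No route item is restated. References: O'Neill 1983, Ch. 1 pp. 3–7, Ch. 3 p. 57, Prop. 3.59 [ONeill1983];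
Anderson 2004, Def. 1.1 [Anderson2004]; Wald 1984, §12.1 [Wald1984]; DHRT arXiv:2104.08222, §1 [arXiv210408222].
-/

noncomputable section

set_option maxSynthPendingDepth 3
set_option linter.dupNamespace false

open Set Filter Function TopologicalSpace Manifold Bundle
open scoped Topology Manifold ContDiff ENNReal NNReal

namespace Summit.FinalStateConjecture.FinalStateConjecture.Theorems.TameLaSalle

open Literature.Geometry.Lorentzian
open Summit.FinalStateConjecture.FinalStateConjecture.Theorems.TameHull

/-! ### §1 Co-restriction of maps into an open submanifold -/

section CodRestrict

variable {EX : Type*} [NormedAddCommGroup EX] [NormedSpace ℝ EX] {HX : Type*} [TopologicalSpace HX]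
  {IX : ModelWithCorners ℝ EX HX} {X : Type*} [TopologicalSpace X] [ChartedSpace HX X]
  {EM : Type*} [NormedAddCommGroup EM] [NormedSpace ℝ EM] {HM : Type*} [TopologicalSpace HM]
  {IM : ModelWithCorners ℝ EM HM} {M : Type*} [TopologicalSpace M] [ChartedSpace HM M]

/-- **The differential of the co-restriction `x ↦ ⟨f x, _⟩ : X → U` of a map into an open submanifold is the
differential of `f`** (`dι = id`; both are the junk value `0` where `f` is not differentiable, the two maps being
differentiable simultaneously, `mdifferentiableAt_subtypeVal_comp_iff`). Lee 2013, Prop. 3.9. [folklore] -/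
theorem mfderiv_opensCodRestrict (U : Opens M) {f : X → M} (hf : ∀ x, f x ∈ U) (x : X) :
    mfderiv IX IM (fun x ↦ (⟨f x, hf x⟩ : U)) x = mfderiv IX IM f x := by
  by_cases hd : MDifferentiableAt IX IM f x
  · have hd' : MDifferentiableAt IX IM (fun x ↦ (⟨f x, hf x⟩ : U)) x :=
      (mdifferentiableAt_subtypeVal_comp_iff U).1 hd
    have h := ((hasMFDerivAt_subtypeVal (I' := IM) (W := U) ⟨f x, hf x⟩).comp x hd'.hasMFDerivAt).mfderiv
    have key : (ContinuousLinearMap.id ℝ EM).comp (mfderiv IX IM (fun x ↦ (⟨f x, hf x⟩ : U)) x) =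
        mfderiv IX IM (fun x ↦ (⟨f x, hf x⟩ : U)) x := ContinuousLinearMap.ext fun _ ↦ rfl
    exact key.symm.trans h.symm
  · have hd' : ¬ MDifferentiableAt IX IM (fun x ↦ (⟨f x, hf x⟩ : U)) x := fun h ↦
      hd ((mdifferentiableAt_subtypeVal_comp_iff U).2 h)
    rw [mfderiv_zero_of_not_mdifferentiableAt hd, mfderiv_zero_of_not_mdifferentiableAt hd']
    rfl

/-- The co-restriction of a `C^∞` map into an open submanifold is `C^∞` (Mathlib's
`ContMDiff.subtypeVal_comp_iff`). Lee 2013, Ch. 5. [folklore] -/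
theorem contMDiff_opensCodRestrict (U : Opens M) {f : X → M} (hf : ∀ x, f x ∈ U)
    (h : ContMDiff IX IM ∞ f) : ContMDiff IX IM ∞ (fun x ↦ (⟨f x, hf x⟩ : U)) :=
  (ContMDiff.subtypeVal_comp_iff U _).1 h

/-- **The co-restriction of a `C^∞` local diffeomorphism to an open submanifold containing its image is a local
diffeomorphism** (restrict the target of the local inverse). O'Neill 1983, Ch. 1, p. 4. [folklore] -/
theorem isLocalDiffeomorph_opensCodRestrict (U : Opens M) {f : X → M} (hf : ∀ x, f x ∈ U)
    (h : IsLocalDiffeomorph IX IM ∞ f) : IsLocalDiffeomorph IX IM ∞ (fun x ↦ (⟨f x, hf x⟩ : U)) := by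
  -- adapted from `IsLocalDiffeomorphAt.codRestrict_opens` (Literature/Topology/FourManifolds/SurgeryGluingTransport.lean)
  intro x
  obtain ⟨Φ, hx, heq⟩ := h x
  have hmapsto : ∀ y ∈ Φ.source, f y ∈ Φ.target := fun y hy ↦ by
    rw [heq hy]; exact Φ.map_source hy
  refine ⟨{ toFun := fun y ↦ ⟨f y, hf y⟩
            invFun := fun u ↦ Φ.toPartialEquiv.symm u
            source := Φ.source
            target := {u | (u : M) ∈ Φ.target}
            map_source' := fun y hy ↦ hmapsto y hy
            map_target' := fun u hu ↦ Φ.toPartialEquiv.map_target hu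
            left_inv' := fun y hy ↦ by
              change Φ.toPartialEquiv.symm (f y) = y
              rw [heq hy]; exact Φ.toPartialEquiv.left_inv hy
            right_inv' := fun u hu ↦ by
              apply Subtype.ext
              change f (Φ.toPartialEquiv.symm u) = u
              rw [heq (Φ.toPartialEquiv.map_target hu)]; exact Φ.toPartialEquiv.right_inv hu
            open_source := Φ.open_source
            open_target := Φ.open_target.preimage continuous_subtype_val
            contMDiffOn_toFun := by
              intro y hy
              refine (ContMDiffWithinAt.subtypeVal_comp_iff U _ _ _).1 ?_
              exact (Φ.contMDiffOn y hy).congr (fun z hz ↦ heq hz) (heq hy)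
            contMDiffOn_invFun := Φ.contMDiffOn_invFun.comp contMDiff_subtype_val.contMDiffOn
              fun u hu ↦ hu }, hx, fun y _ ↦ rfl⟩

end CodRestrict

/-! ### §2 Chart deviations and late charts read in a sub-spacetime -/

variable {𝓢 : Spacetime.{0} 4} {U : Opens 𝓢.carrier} (hU : IsConnected (U : Set 𝓢.carrier))

/-- **The deviation `Ψ^* g − g₀` of a chart is unchanged when `Ψ` is read in the sub-spacetime `𝓢|_U ⊇ range Ψ`**
(`(g|_U)_{Ψ x} = g_{Ψ x}` and the co-restricted chart has the same differential). DHRT arXiv:2104.08222, §1.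
[cite: arXiv210408222, §1] -/
theorem deviation_restrict_opensCodRestrict (B : ModelBackground) {Ψ : B.domain → 𝓢.carrier}
    (hΨ : ∀ x, Ψ x ∈ U) (x : B.domain) :
    (𝓢.restrict PseudoRiemannianMetric.contMDiff_restrict_holds 𝓢.timeOrientation.contMDiff_restrict_holds
        U hU).deviation B (fun x ↦ (⟨Ψ x, hΨ x⟩ : U)) x = 𝓢.deviation B Ψ x := by
  ext v w
  rw [Spacetime.deviation_apply, Spacetime.deviation_apply]
  change 𝓢.metric.val (Ψ x) (mfderiv 𝓘(ℝ, E4) (𝓡 4) (fun x ↦ (⟨Ψ x, hΨ x⟩ : U)) x v)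
      (mfderiv 𝓘(ℝ, E4) (𝓡 4) (fun x ↦ (⟨Ψ x, hΨ x⟩ : U)) x w) - B.bilin x.1 v w = _
  rw [mfderiv_opensCodRestrict]
  rfl

/-- The extended deviation is likewise unchanged. [cite: arXiv210408222, §1] -/
theorem deviationExtend_restrict_opensCodRestrict (B : ModelBackground) {Ψ : B.domain → 𝓢.carrier}
    (hΨ : ∀ x, Ψ x ∈ U) :
    (𝓢.restrict PseudoRiemannianMetric.contMDiff_restrict_holds 𝓢.timeOrientation.contMDiff_restrict_holds
        U hU).deviationExtend B (fun x ↦ (⟨Ψ x, hΨ x⟩ : U)) = 𝓢.deviationExtend B Ψ := by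
  unfold Spacetime.deviationExtend
  congr 1
  exact funext fun x ↦ deviation_restrict_opensCodRestrict hU B hΨ x

/-- **A late chart with values in `U`, read in `𝓢|_U`, is a late chart** (smoothness and open-embedding of the late
region pass to the co-restriction, `Topology.IsOpenEmbedding.of_comp`). DHRT arXiv:2104.08222, §1. [cite: arXiv210408222, §1] -/
theorem isLateChart_restrict_opensCodRestrict (B : ModelBackground) {𝒟 : Set 𝓢.carrier} {τ₀ : ℝ}
    {Ψ : B.domain → 𝓢.carrier} (hΨ : ∀ x, Ψ x ∈ U) (h : 𝓢.IsLateChart B 𝒟 τ₀ Ψ) :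
    (𝓢.restrict PseudoRiemannianMetric.contMDiff_restrict_holds 𝓢.timeOrientation.contMDiff_restrict_holds
        U hU).IsLateChart B (Subtype.val ⁻¹' 𝒟) τ₀ (fun x ↦ (⟨Ψ x, hΨ x⟩ : U)) := by
  refine ⟨contMDiff_opensCodRestrict U hΨ h.contMDiff, ?_, ?_⟩
  · exact Topology.IsOpenEmbedding.of_comp _ U.2.isOpenEmbedding_subtypeVal h.isOpenEmbedding
  · rintro _ ⟨x, hx, rfl⟩
    exact h.image_subset ⟨x, hx, rfl⟩

/-! ### §3 The transported end: d.o.c., horizon, far deviation -/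

variable (E : EndDatum 𝓢) (hfar : ∀ x, E.far x ∈ U)

-- The TRANSPORTED end datum of the sub-spacetime `𝓢|_U` is written as the term
-- `⟨E.M, E.R, E.C, fun x ↦ (⟨E.far x, hfar x⟩ : U), fun y : U ↦ E.clock y.1⟩` throughout (no definition, no notation).

/-- The far cylinder of the transported end is the preimage of the far cylinder. [folklore] -/
theorem range_far_transport :
    Set.range (fun x ↦ (⟨E.far x, hfar x⟩ : U)) = Subtype.val ⁻¹' Set.range E.far := by
  ext y
  constructor
  · rintro ⟨x, rfl⟩; exact ⟨x, rfl⟩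
  · rintro ⟨x, hx⟩; exact ⟨x, Subtype.ext hx⟩

/-- **The d.o.c. of the transported end is `ι⁻¹ E.doc`** (`docOfEnd_restrict_eq_preimage`, for `U ⊇ E.doc ∪ range E.far`).
Wald 1984, §12.1. [cite: Wald1984, §12.1] -/
theorem doc_transport (hdoc : E.doc ⊆ U) : EndDatum.doc (⟨E.M, E.R, E.C, fun x ↦ (⟨E.far x, hfar x⟩ : U), fun y : U ↦ E.clock y.1⟩ : EndDatum
      (𝓢.restrict PseudoRiemannianMetric.contMDiff_restrict_holds 𝓢.timeOrientation.contMDiff_restrict_holds U hU)) = Subtype.val ⁻¹' E.doc := by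
  rw [EndDatum.doc, show Set.range (EndDatum.far (⟨E.M, E.R, E.C, fun x ↦ (⟨E.far x, hfar x⟩ : U), fun y : U ↦ E.clock y.1⟩ : EndDatum
      (𝓢.restrict PseudoRiemannianMetric.contMDiff_restrict_holds 𝓢.timeOrientation.contMDiff_restrict_holds U hU))) = Subtype.val ⁻¹' Set.range E.far from
    range_far_transport E hfar]
  exact docOfEnd_restrict_eq_preimage hU (by rintro _ ⟨x, rfl⟩; exact hfar x) hdoc

/-- **The future event horizon of the transported end is `ι⁻¹ E.horizon`**
(`futureEventHorizonOfEnd_restrict_eq_preimage`). Wald 1984, §12.1. [cite: Wald1984, §12.1] -/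
theorem horizon_transport (hdoc : E.doc ⊆ U) : EndDatum.horizon (⟨E.M, E.R, E.C, fun x ↦ (⟨E.far x, hfar x⟩ : U), fun y : U ↦ E.clock y.1⟩ : EndDatum
      (𝓢.restrict PseudoRiemannianMetric.contMDiff_restrict_holds 𝓢.timeOrientation.contMDiff_restrict_holds U hU)) = Subtype.val ⁻¹' E.horizon := by
  rw [EndDatum.horizon, show Set.range (EndDatum.far (⟨E.M, E.R, E.C, fun x ↦ (⟨E.far x, hfar x⟩ : U), fun y : U ↦ E.clock y.1⟩ : EndDatum
      (𝓢.restrict PseudoRiemannianMetric.contMDiff_restrict_holds 𝓢.timeOrientation.contMDiff_restrict_holds U hU))) = Subtype.val ⁻¹' Set.range E.far from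
    range_far_transport E hfar]
  exact futureEventHorizonOfEnd_restrict_eq_preimage hU (by rintro _ ⟨x, rfl⟩; exact hfar x) hdoc

/-- **The far deviation of the transported end is that of `E`.** [cite: arXiv210408222, §1] -/
theorem h_transport : EndDatum.h (⟨E.M, E.R, E.C, fun x ↦ (⟨E.far x, hfar x⟩ : U), fun y : U ↦ E.clock y.1⟩ : EndDatum
      (𝓢.restrict PseudoRiemannianMetric.contMDiff_restrict_holds 𝓢.timeOrientation.contMDiff_restrict_holds U hU)) = E.h :=
  deviationExtend_restrict_opensCodRestrict hU _ hfar

/-- … and so is its chart-time derivative. [cite: arXiv210408222, §1] -/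
theorem hdot_transport : EndDatum.hdot (⟨E.M, E.R, E.C, fun x ↦ (⟨E.far x, hfar x⟩ : U), fun y : U ↦ E.clock y.1⟩ : EndDatum
      (𝓢.restrict PseudoRiemannianMetric.contMDiff_restrict_holds 𝓢.timeOrientation.contMDiff_restrict_holds U hU)) = E.hdot := by
  unfold EndDatum.hdot
  rw [h_transport]

/-- **Two-sided non-radiation is a property of the far deviation alone, hence transports.**
[cite: AlexakisSchlue2018, Thm. 1.1] -/
theorem isNonRadiating_transport_iff : EndDatum.IsNonRadiating (⟨E.M, E.R, E.C, fun x ↦ (⟨E.far x, hfar x⟩ : U), fun y : U ↦ E.clock y.1⟩ : EndDatum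
      (𝓢.restrict PseudoRiemannianMetric.contMDiff_restrict_holds 𝓢.timeOrientation.contMDiff_restrict_holds U hU)) ↔ E.IsNonRadiating := by
  unfold EndDatum.IsNonRadiating
  rw [hdot_transport]

/-! ### §4 Vacuum, tameness at every order and the all-orders class transport -/

/-- **Vacuum restricts**: `Ric(g|_U) = 0` if `Ric(g) = 0` (the restricted metric is the pullback along the inclusion,
`PseudoRiemannianMetric.restrict_eq_comap`; locality of curvature, `ricci_comap_apply`). O'Neill 1983, Ch. 3,
Prop. 3.59. [cite: ONeill1983, Ch. 3, Prop. 3.59] -/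
theorem isRicciFlat_restrict (hvac : ∀ [𝓢.metric.HasLeviCivita], 𝓢.metric.toPseudoRiemannianMetric.IsRicciFlat)
    [(𝓢.restrict PseudoRiemannianMetric.contMDiff_restrict_holds 𝓢.timeOrientation.contMDiff_restrict_holds
      U hU).metric.HasLeviCivita] :
    (𝓢.restrict PseudoRiemannianMetric.contMDiff_restrict_holds 𝓢.timeOrientation.contMDiff_restrict_holds
      U hU).metric.toPseudoRiemannianMetric.IsRicciFlat := by
  -- adapted from `DataEmbedding.isRicciFlat_restrict` (CauchyDevelopmentRestrict.lean)
  intro y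
  haveI := 𝓢.metric.toPseudoRiemannianMetric.hasLeviCivita
  set gc := 𝓢.metric.toPseudoRiemannianMetric.comap
    PseudoRiemannianMetric.contMDiff_pullbackBilin_holds (Subtype.val : U → 𝓢.carrier)
    contMDiff_subtype_val (injective_mfderiv_subtypeVal U) rfl with hgc_def
  haveI hgcLC : gc.HasLeviCivita := gc.hasLeviCivita
  have hgc : (𝓢.restrict PseudoRiemannianMetric.contMDiff_restrict_holds 𝓢.timeOrientation.contMDiff_restrict_holds
      U hU).metric.toPseudoRiemannianMetric = gc :=
    PseudoRiemannianMetric.restrict_eq_comap 𝓢.metric.toPseudoRiemannianMetric U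
  rw [PseudoRiemannianMetric.ricci_congr_metric hgc inferInstance hgcLC]
  refine LinearMap.ext fun Y₀ ↦ LinearMap.ext fun Z₀ ↦ ?_
  have key : gc.ricci y Y₀ Z₀ = 𝓢.metric.toPseudoRiemannianMetric.ricci y.1
      (mfderiv (𝓡 4) (𝓡 4) (Subtype.val : U → 𝓢.carrier) y Y₀)
      (mfderiv (𝓡 4) (𝓡 4) (Subtype.val : U → 𝓢.carrier) y Z₀) :=
    PseudoRiemannianMetric.ricci_comap_apply 𝓢.metric.toPseudoRiemannianMetric
      PseudoRiemannianMetric.contMDiff_pullbackBilin_holds (Φ := (Subtype.val : U → 𝓢.carrier))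
      contMDiff_subtype_val (injective_mfderiv_subtypeVal U) rfl y Y₀ Z₀
  refine key.trans ?_
  rw [hvac y.1]
  rfl

/-- **Clock-adapted tame balls INSIDE `U` are clock-adapted tame balls of the transported end** (order `k`, constant
`Λ`): the chart read in `𝓢|_U` is a late chart with the same centre, the same deviation (hence the same `Cᵏ` and `C⁰`
sup norms), the same `∂₀` and the same clock. Anderson 2004, Def. 1.1. [cite: Anderson2004, Def. 1.1] -/
theorem tameBall_transport (k : ℕ) (Λ : ℝ≥0) (r₀ : ℝ) {q : 𝓢.carrier} (hqU : q ∈ U)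
    (hball : let V : Opens E4 := ⟨Metric.ball (0 : E4) r₀, Metric.isOpen_ball⟩
      ∃ Ψ : V → 𝓢.carrier, 𝓢.IsLateChart (Minkowski.backgroundOn V) Set.univ (-r₀) Ψ ∧
        (∃ x : V, (x : E4) = 0 ∧ Ψ x = q) ∧
        supCkENorm (V : Set E4) k (𝓢.deviationExtend (Minkowski.backgroundOn V) Ψ) ≤ (Λ : ℝ≥0∞) ∧
        supCkENorm (V : Set E4) 0 (𝓢.deviationExtend (Minkowski.backgroundOn V) Ψ) ≤ 1 / 2 ∧
        (∀ x : V, 𝓢.timeOrientation.IsFutureDirected (mfderiv 𝓘(ℝ, E4) (𝓡 4) Ψ x (E4.basisVector 0))) ∧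
        (∀ x : V, E.clock (Ψ x) = (x : E4) 0 + E.clock q) ∧ ∀ x : V, Ψ x ∈ U) :
    let V : Opens E4 := ⟨Metric.ball (0 : E4) r₀, Metric.isOpen_ball⟩
    ∃ Ψ : V → (𝓢.restrict PseudoRiemannianMetric.contMDiff_restrict_holds
        𝓢.timeOrientation.contMDiff_restrict_holds U hU).carrier,
      (𝓢.restrict PseudoRiemannianMetric.contMDiff_restrict_holds 𝓢.timeOrientation.contMDiff_restrict_holds
          U hU).IsLateChart (Minkowski.backgroundOn V) Set.univ (-r₀) Ψ ∧
      (∃ x : V, (x : E4) = 0 ∧ Ψ x = ⟨q, hqU⟩) ∧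
      supCkENorm (V : Set E4) k ((𝓢.restrict PseudoRiemannianMetric.contMDiff_restrict_holds
        𝓢.timeOrientation.contMDiff_restrict_holds U hU).deviationExtend (Minkowski.backgroundOn V) Ψ) ≤ (Λ : ℝ≥0∞) ∧
      supCkENorm (V : Set E4) 0 ((𝓢.restrict PseudoRiemannianMetric.contMDiff_restrict_holds
        𝓢.timeOrientation.contMDiff_restrict_holds U hU).deviationExtend (Minkowski.backgroundOn V) Ψ) ≤ 1 / 2 ∧
      (∀ x : V, (𝓢.restrict PseudoRiemannianMetric.contMDiff_restrict_holds
        𝓢.timeOrientation.contMDiff_restrict_holds U hU).timeOrientation.IsFutureDirected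
          (mfderiv 𝓘(ℝ, E4) (𝓡 4) Ψ x (E4.basisVector 0))) ∧
      ∀ x : V, E.clock (Ψ x).1 = (x : E4) 0 + E.clock q := by
  intro V
  obtain ⟨Ψ, hlate, ⟨x₀, hx₀, hΨx₀⟩, hk, h0, hfut, hclock, hΨU⟩ := hball
  refine ⟨fun x ↦ (⟨Ψ x, hΨU x⟩ : U), ?_, ⟨x₀, hx₀, Subtype.ext hΨx₀⟩, ?_, ?_, fun x ↦ ?_, hclock⟩
  · have h := isLateChart_restrict_opensCodRestrict hU (Minkowski.backgroundOn V) hΨU hlate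
    rwa [Set.preimage_univ] at h
  · exact (congrArg (supCkENorm (V : Set E4) k)
      (deviationExtend_restrict_opensCodRestrict hU (Minkowski.backgroundOn V) hΨU)).trans_le hk
  · exact (congrArg (supCkENorm (V : Set E4) 0)
      (deviationExtend_restrict_opensCodRestrict hU (Minkowski.backgroundOn V) hΨU)).trans_le h0
  · change 𝓢.timeOrientation.IsFutureDirected (x := Ψ x)
      (mfderiv 𝓘(ℝ, E4) (𝓡 4) (fun x ↦ (⟨Ψ x, hΨU x⟩ : U)) x (E4.basisVector 0))
    rw [mfderiv_opensCodRestrict]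
    exact hfut x

/-- **Order-`k` tameness transports** given order-`k` balls inside `U ⊇ E.doc ∪ range E.far`. Anderson 2004, Def. 1.1.
[cite: Anderson2004, Def. 1.1] -/
theorem isTameEndOrder_transport (hdoc : E.doc ⊆ U) {k : ℕ} {Λ : ℝ≥0} {r₀ : ℝ}
    (hfb : ∀ m ≤ k, ∀ x : Kerr.region (0 : ℝ) E.R, ‖iteratedFDeriv ℝ m E.h x.1‖ * Kerr.radius 0 x.1 ≤ Λ)
    (hballs : ∀ q ∈ E.doc, let V : Opens E4 := ⟨Metric.ball (0 : E4) r₀, Metric.isOpen_ball⟩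
      ∃ Ψ : V → 𝓢.carrier, 𝓢.IsLateChart (Minkowski.backgroundOn V) Set.univ (-r₀) Ψ ∧
        (∃ x : V, (x : E4) = 0 ∧ Ψ x = q) ∧
        supCkENorm (V : Set E4) k (𝓢.deviationExtend (Minkowski.backgroundOn V) Ψ) ≤ (Λ : ℝ≥0∞) ∧
        supCkENorm (V : Set E4) 0 (𝓢.deviationExtend (Minkowski.backgroundOn V) Ψ) ≤ 1 / 2 ∧
        (∀ x : V, 𝓢.timeOrientation.IsFutureDirected (mfderiv 𝓘(ℝ, E4) (𝓡 4) Ψ x (E4.basisVector 0))) ∧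
        (∀ x : V, E.clock (Ψ x) = (x : E4) 0 + E.clock q) ∧ ∀ x : V, Ψ x ∈ U) :
    IsTameEndOrder (⟨E.M, E.R, E.C, fun x ↦ (⟨E.far x, hfar x⟩ : U), fun y : U ↦ E.clock y.1⟩ : EndDatum
      (𝓢.restrict PseudoRiemannianMetric.contMDiff_restrict_holds 𝓢.timeOrientation.contMDiff_restrict_holds U hU))
      k Λ r₀ := by
  refine ⟨fun m hm x ↦ ?_, fun q hq ↦ ?_⟩
  · rw [h_transport]; exact hfb m hm x
  · rw [doc_transport hU E hfar hdoc] at hq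
    exact tameBall_transport hU E k Λ r₀ q.2 (hballs q.1 hq)

/-- **The `C³` interface transports**: vacuum (`isRicciFlat_restrict`), far chart (co-restricted local diffeomorphism,
same injectivity, bounds and `∂₀`), clock (restriction of a smooth function, `= x⁰` on the far chart) and — given inside
`U` — the clock-adapted tame balls. Anderson 2004, Def. 1.1 and Thm 5.1. [cite: Anderson2004, Def. 1.1 and Thm 5.1] -/
theorem isTameEnd_transport (hdoc : E.doc ⊆ U) {Λ : ℝ≥0} {r₀ : ℝ} (hE : E.IsTameEnd Λ r₀)
    (hballs : ∀ q ∈ E.doc, let V : Opens E4 := ⟨Metric.ball (0 : E4) r₀, Metric.isOpen_ball⟩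
      ∃ Ψ : V → 𝓢.carrier, 𝓢.IsLateChart (Minkowski.backgroundOn V) Set.univ (-r₀) Ψ ∧
        (∃ x : V, (x : E4) = 0 ∧ Ψ x = q) ∧
        supCkENorm (V : Set E4) 3 (𝓢.deviationExtend (Minkowski.backgroundOn V) Ψ) ≤ (Λ : ℝ≥0∞) ∧
        supCkENorm (V : Set E4) 0 (𝓢.deviationExtend (Minkowski.backgroundOn V) Ψ) ≤ 1 / 2 ∧
        (∀ x : V, 𝓢.timeOrientation.IsFutureDirected (mfderiv 𝓘(ℝ, E4) (𝓡 4) Ψ x (E4.basisVector 0))) ∧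
        (∀ x : V, E.clock (Ψ x) = (x : E4) 0 + E.clock q) ∧ ∀ x : V, Ψ x ∈ U) :
    EndDatum.IsTameEnd (⟨E.M, E.R, E.C, fun x ↦ (⟨E.far x, hfar x⟩ : U), fun y : U ↦ E.clock y.1⟩ : EndDatum
      (𝓢.restrict PseudoRiemannianMetric.contMDiff_restrict_holds 𝓢.timeOrientation.contMDiff_restrict_holds U hU))
      Λ r₀ where
  r₀_pos := hE.r₀_pos
  mass_nonneg := hE.mass_nonneg
  lt_R := hE.lt_R
  vacuum := by
    intro inst
    exact isRicciFlat_restrict hU hE.vacuum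
  far_isLocalDiffeomorph := isLocalDiffeomorph_opensCodRestrict U hfar hE.far_isLocalDiffeomorph
  far_injective := fun x y hxy ↦ hE.far_injective (congrArg Subtype.val hxy)
  far_bound := fun m hm x ↦ by
    rw [h_transport]; exact hE.far_bound m hm x
  far_future := fun x ↦ by
    change 𝓢.timeOrientation.IsFutureDirected (x := E.far x)
      (mfderiv 𝓘(ℝ, E4) (𝓡 4) (fun x ↦ (⟨E.far x, hfar x⟩ : U)) x (E4.basisVector 0))
    rw [mfderiv_opensCodRestrict]
    exact hE.far_future x
  clock_smooth := hE.clock_smooth.comp contMDiff_subtype_val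
  clock_far := fun x ↦ hE.clock_far x
  tame := fun q hq ↦ by
    rw [doc_transport hU E hfar hdoc] at hq
    exact tameBall_transport hU E 3 Λ r₀ q.2 (hballs q.1 hq)

/-- **The all-orders class transports (registered sub-goal `isTameClass_transport` of stmt-FinalStateConjecture-17430).**
If `E` is in the class `(Λ, r₀)` and the open sub-spacetime `U ⊇ E.doc ∪ range E.far` contains, for every order `k` and
every point of `E.doc`, a clock-adapted centred tame ball of `E` of order `k` (constant `Λ k`, radius `r₀`), then the
transported end of `𝓢|_U` is in the class `(Λ, r₀)`. This isolates exactly what the sub-spacetime witness of stub D must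
contain: the d.o.c., the far cylinder, and a clock-adapted collar. Anderson 2004, Def. 1.1 and Thm 5.1.
[cite: Anderson2004, Def. 1.1 and Thm 5.1] -/
theorem isTameClass_transport : ∀ {𝓢 : Spacetime.{0} 4} {U : Opens 𝓢.carrier} (hU : IsConnected (U : Set 𝓢.carrier)) (E : EndDatum 𝓢) (hfar : ∀ x, E.far x ∈ U), E.doc ⊆ U → ∀ {Λ : ℕ → ℝ≥0} {r₀ : ℝ}, IsTameClass E Λ r₀ → (∀ (k : ℕ), ∀ q ∈ E.doc, let V : Opens E4 := ⟨Metric.ball (0 : E4) r₀, Metric.isOpen_ball⟩; ∃ Ψ : V → 𝓢.carrier, 𝓢.IsLateChart (Minkowski.backgroundOn V) Set.univ (-r₀) Ψ ∧ (∃ x : V, (x : E4) = 0 ∧ Ψ x = q) ∧ supCkENorm (V : Set E4) k (𝓢.deviationExtend (Minkowski.backgroundOn V) Ψ) ≤ (Λ k : ℝ≥0∞) ∧ supCkENorm (V : Set E4) 0 (𝓢.deviationExtend (Minkowski.backgroundOn V) Ψ) ≤ 1 / 2 ∧ (∀ x : V, 𝓢.timeOrientation.IsFutureDirected (mfderiv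 𝓘(ℝ, E4) (𝓡 4) Ψ x (E4.basisVector 0))) ∧ (∀ x : V, E.clock (Ψ x) = (x : E4) 0 + E.clock q) ∧ ∀ x : V, Ψ x ∈ U) → IsTameClass (⟨E.M, E.R, E.C, fun x ↦ (⟨E.far x, hfar x⟩ : U), fun y : U ↦ E.clock y.1⟩ : EndDatum (𝓢.restrict PseudoRiemannianMetric.contMDiff_restrict_holds 𝓢.timeOrientation.contMDiff_restrict_holds U hU)) Λ r₀ := by
  intro 𝓢 U hU E hfar hdoc Λ r₀ hcls hballs
  exact ⟨isTameEnd_transport hU E hfar hdoc hcls.isTameEnd (hballs 3), hcls.R_le, hcls.C_le,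
    fun k ↦ isTameEndOrder_transport hU E hfar hdoc (hcls.order k).far_bound (hballs k)⟩

end Summit.FinalStateConjecture.FinalStateConjecture.Theorems.TameLaSalle

end
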